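import Summits.BirchSwinnertonDyer.BirchSwinnertonDyer.Theorems.KolyvaginRoadThreeZhangSupplyLocalH1CardKolyvagin
import Summits.BirchSwinnertonDyer.BirchSwinnertonDyer.Theorems.Rank1ResidualJetKolyvaginDecompositionTrivial
import HarnessLib

/-!
# Route `AdditiveKolyvaginRoad`, crux `KolyvaginPrimitiveAdditive` (item stmt-BirchSwinnertonDyer-20132):
# stub LOC, towards (Supply) at a general odd prime `p` — `#H¹(K_λ, E[p]) = p⁴` AT A ZHANG–KOLYVAGIN PRIME
# (the binder `hw : p² < #H¹(K_λ, E[p])` of the unsigned jump of the (Supply) chain; p-generic port of koly3b's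
# `…ZhangSupplyLocalH1Card` ∕ `…LocalH1CardKolyvagin`, parts XV ∕ XVII, `3 ↦ p¹`)
# (cell `pub/bsd-wall`, lead prover `bsd-wall-akr-p1` g3; `--supports stmt-BirchSwinnertonDyer-20132`, helper)

WHY THIS FILE. Stub LOC of crux 20132 is reduced to (Supply) (p540947); its local line-rigidity input (IsoBound) is
p-generic (p542338 p544277 p545212 + `…KolyvaginIsoBound`). The GLOBAL half of (Supply) (koly3b's `hSupply_of_poitouTate`
chain) starts from the unsigned jump at a Kolyvagin prime `λ`, whose one local input is `#E(K_λ)[p]² = p⁴ > p²`, i.e.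
`#H¹(K_λ, E[p]) = p⁴` (Milne I Thm. 2.8 with `Γ_λ` fixing `E[p]`). This file ports it to a general prime `p`.

WHAT. `natCard_invariants_eq_sq_of_decomposition_le_torsionFixing_P` (`#E[p]^{Γ_{K_v}} = p²` when a decomposition
group above `v` fixes `E[p]`), `natCard_galoisCohomology_one_toLocal_eq_of_decomposition_le_torsionFixing_P`
(`#H¹(K_v, E[p]) = (p²)²`, `v ∤ p`), and at a Zhang–Kolyvagin prime of an imaginary quadratic `K` (`p` odd, `ρ̄_{E,p}`
onto): `natCard_invariants_eq_sq_of_kolyvagin_P`, `natCard_galoisCohomology_one_toLocal_eq_of_kolyvagin_P`,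
`sq_lt_natCard_galoisCohomology_one_toLocal_of_kolyvagin_P`.

HONEST FRAMING: theorems only; 0 definitions, 0 named facts, 0 `sorry`; closes nothing.

References: [cite: MilneADT2006, Ch. I, Thm. 2.8] [cite: NeukirchANT1999, Ch. II §9 (9.6)] [cite: GrossLMS1991, §3 (3.3)].
-/

-- single-conjunct summit: `Summit.BirchSwinnertonDyer.BirchSwinnertonDyer.…` repeats the name by design
set_option linter.dupNamespace false

noncomputable section

open scoped Classical Pointwise

namespace Summit.BirchSwinnertonDyer.BirchSwinnertonDyer.Theorems.AdditiveKoly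

open CategoryTheory WeierstrassCurve Field Function NumberField IsDedekindDomain
open Literature.NumberTheory.EllipticCurves Literature.NumberTheory.GaloisRepresentations
open Summit.BirchSwinnertonDyer.Rank1Residual.GaloisImage
  Summit.BirchSwinnertonDyer.Rank1Residual.GaloisImage.LocalH1UnramifiedSquare
open Summit.BirchSwinnertonDyer.Rank1Residual.X11b.Three.Koly.Method2
open Summit.BirchSwinnertonDyer.Rank1Residual.JET Summit.BirchSwinnertonDyer.Rank1Residual.X11b

variable (W : WeierstrassCurve ℚ) (K : Type) [Field K] [NumberField K] (p : ℕ) [W.IsElliptic] [W.IsGloballyMinimal]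
  [Fact p.Prime]

omit [W.IsGloballyMinimal] in
/-- **If some decomposition group above `v` fixes `E[p]`, every `p`-torsion point is `K_v`-rational**: the invariants of
`Γ_{K_v}` on `E[p](K̄)` (restricted module) are everything, so they number `p²`. [cite: NeukirchANT1999, Ch. II §9 (9.6)] -/
theorem natCard_invariants_eq_sq_of_decomposition_le_torsionFixing_P (v : HeightOneSpectrum (𝓞 K))
    (hD : ∀ 𝔓 ∈ v.primesAbove,
      𝔓.decompositionSubgroup (absoluteGaloisGroup K) ≤ torsionFixing (W.baseChange K) ((p ^ 1 : ℕ) : ℤ)) :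
    Nat.card (GaloisRep.restrictField (v.adicCompletion K)
      ((W.baseChange K).torsionGaloisModule ((p ^ 1 : ℕ) : ℤ))).toTopRep.ρ.invariants = (p ^ 1) ^ 2 := by
  have hp : p.Prime := Fact.out
  -- the prime of `ℤ̄_K` cut out by the chosen embedding `K̄ → K̄_v`
  set ι₀ := closureEmb (K := K) (v.adicCompletion K) with hι₀
  obtain ⟨𝔐, h𝔐⟩ := v.localPrimesAbove_nonempty
  set 𝔓 := v.primeBelow ι₀ 𝔐 with h𝔓def
  have h𝔓 : 𝔓 ∈ v.primesAbove := HeightOneSpectrum.primeBelow_mem_primesAbove h𝔐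
  set H := (GaloisRep.restrictField (v.adicCompletion K)
      ((W.baseChange K).torsionGaloisModule ((p ^ 1 : ℕ) : ℤ))).toTopRep.ρ.invariants with hHdef
  -- every point is invariant
  have htop : ∀ Q : geomTorsion (W.baseChange K) ((p ^ 1 : ℕ) : ℤ), Q ∈ H := by
    intro Q
    refine (ContRepresentation.mem_invariants _).mpr fun σ ↦ ?_
    have hσ : resGal (K := K) (v.adicCompletion K) σ ∈ 𝔓.decompositionSubgroup (absoluteGaloisGroup K) := by
      rw [resGal_eq]; exact resGalOfEmb_mem_decompositionSubgroup ι₀ h𝔐 σ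
    have hfix := smul_eq_of_mem_torsionFixing (W.baseChange K) ((p ^ 1 : ℕ) : ℤ) (hD 𝔓 h𝔓 hσ) Q
    change absGaloisRestrict K (v.adicCompletion K) σ • Q = Q
    rwa [← resGal_eq_absGaloisRestrict]
  have h9 : Nat.card (geomTorsion (W.baseChange K) ((p ^ 1 : ℕ) : ℤ)) = (p ^ 1) ^ 2 :=
    card_torsionPoints_eq_sq_holds (W.baseChange K) (AlgebraicClosure K) (n := p ^ 1)
      (by exact_mod_cast pow_ne_zero 1 hp.ne_zero)
  have hHtop : H.toAddSubgroup = ⊤ := by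
    rw [eq_top_iff]
    intro Q _
    exact htop Q
  change Nat.card H.toAddSubgroup = (p ^ 1) ^ 2
  rw [hHtop, AddSubgroup.card_top, h9]

omit [W.IsGloballyMinimal] in
/-- **`#H¹(K_v, E[p]) = (p²)²`** at a finite place `v ∤ p` some decomposition group above which fixes `E[p]`: Milne I
Thm. 2.8 (`#H¹ = #E(K_v)[p]²`, `natCard_galoisCohomology_one_primeTorsion_adicCompletion_eq_sq_of_not_mem`) with
`#E(K_v)[p] = p²`. [cite: MilneADT2006, Ch. I, Thm. 2.8] [cite: NeukirchANT1999, Ch. II §9 (9.6)] -/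
theorem natCard_galoisCohomology_one_toLocal_eq_of_decomposition_le_torsionFixing_P (v : HeightOneSpectrum (𝓞 K))
    (hpv : ((p : ℕ) : 𝓞 K) ∉ v.asIdeal)
    (hD : ∀ 𝔓 ∈ v.primesAbove,
      𝔓.decompositionSubgroup (absoluteGaloisGroup K) ≤ torsionFixing (W.baseChange K) ((p ^ 1 : ℕ) : ℤ)) :
    Nat.card (galoisCohomology (((W.baseChange K).torsionGaloisModule ((p ^ 1 : ℕ) : ℤ)).toLocal (Sum.inr v)) 1) =
      ((p ^ 1) ^ 2) ^ 2 := by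
  have hp : p.Prime := Fact.out
  haveI : CharZero (v.adicCompletion K) := charZero_of_injective_algebraMap (algebraMap K _).injective
  have h1 := natCard_galoisCohomology_one_primeTorsion_adicCompletion_eq_sq_of_not_mem (W.baseChange K) v p hpv
  have h0 := natCard_invariants_torsion_restrictField (W.baseChange K) (v.adicCompletion K) (n := p) hp.ne_zero
  have h9 := natCard_invariants_eq_sq_of_decomposition_le_torsionFixing_P W K p v hD
  have hp1 : (p ^ 1 : ℕ) = p := pow_one p
  change Nat.card (galoisCohomology
    (GaloisRep.restrictField (v.adicCompletion K) ((W.baseChange K).torsionGaloisModule ((p ^ 1 : ℕ) : ℤ))) 1) = _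
  rw [hp1] at h9 ⊢
  rw [h1, ← h0, h9]

/-- **At a Zhang–Kolyvagin prime of an imaginary quadratic `K` (`p` odd, `ρ̄_{E,p}` onto) every `p`-torsion point is
`K_λ`-rational**: `#E[p]^{Γ_{K_λ}} = p²` (the decomposition group at the prime of the chosen embedding fixes `E[p]`:
bsd-jet `GlobalDuality.decompositionSubgroup_le_torsionFixing`). [cite: GrossLMS1991, §3 (3.3)]
[cite: NeukirchANT1999, Ch. II §9 (9.6)] -/
theorem natCard_invariants_eq_sq_of_kolyvagin_P (hK : IsImaginaryQuadratic K) {ℓ : ℕ}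
    (hℓ : Zhang2014.IsKolyvaginPrime (W.conductorNorm ℤ) W K p ℓ) (v : HeightOneSpectrum (𝓞 K))
    (hv : (ℓ : 𝓞 K) ∈ v.asIdeal) :
    Nat.card (GaloisRep.restrictField (v.adicCompletion K)
      ((W.baseChange K).torsionGaloisModule ((p ^ 1 : ℕ) : ℤ))).toTopRep.ρ.invariants = (p ^ 1) ^ 2 := by
  have hk1 : 1 ≤ Zhang2014.kolyvaginIndex W p ℓ := hℓ.2.2.2.2.2
  exact natCard_invariants_eq_sq_of_decomposition_le_torsionFixing_P W K p v
    fun 𝔓 h𝔓 ↦ GlobalDuality.decompositionSubgroup_le_torsionFixing W K hK hℓ hk1 v hv h𝔓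

/-- **`#H¹(K_λ, E[p]) = (p²)²` at a Zhang–Kolyvagin prime** (Milne I Thm. 2.8 with `#E(K_λ)[p] = p²`; `λ ∤ p` by
`hasGoodReductionAt_of_zhangKolyvaginPrime`). [cite: MilneADT2006, Ch. I, Thm. 2.8] [cite: GrossLMS1991, §3 (3.3)] -/
theorem natCard_galoisCohomology_one_toLocal_eq_of_kolyvagin_P (hK : IsImaginaryQuadratic K) {ℓ : ℕ}
    (hℓ : Zhang2014.IsKolyvaginPrime (W.conductorNorm ℤ) W K p ℓ) (v : HeightOneSpectrum (𝓞 K))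
    (hv : (ℓ : 𝓞 K) ∈ v.asIdeal) :
    Nat.card (galoisCohomology (((W.baseChange K).torsionGaloisModule ((p ^ 1 : ℕ) : ℤ)).toLocal (Sum.inr v)) 1) =
      ((p ^ 1) ^ 2) ^ 2 := by
  have hk1 : 1 ≤ Zhang2014.kolyvaginIndex W p ℓ := hℓ.2.2.2.2.2
  have hpv : ((p : ℕ) : 𝓞 K) ∉ v.asIdeal := by
    have h := (GlobalDuality.hasGoodReductionAt_of_zhangKolyvaginPrime W K hℓ v hv 1).2
    rwa [pow_one, Int.cast_natCast] at h
  exact natCard_galoisCohomology_one_toLocal_eq_of_decomposition_le_torsionFixing_P W K p v hpv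
    fun 𝔓 h𝔓 ↦ GlobalDuality.decompositionSubgroup_le_torsionFixing W K hK hℓ hk1 v hv h𝔓

/-- **`p² < #H¹(K_λ, E[p])` at a Zhang–Kolyvagin prime** — the binder `hw` of the unsigned jump of the (Supply) chain
(koly3b `hjump_of_lagrangian`) at a general prime `p`. [cite: MilneADT2006, Ch. I, Thm. 2.8] [cite: GrossLMS1991, §3 (3.3)] -/
theorem sq_lt_natCard_galoisCohomology_one_toLocal_of_kolyvagin_P (hK : IsImaginaryQuadratic K) {ℓ : ℕ}
    (hℓ : Zhang2014.IsKolyvaginPrime (W.conductorNorm ℤ) W K p ℓ) (v : HeightOneSpectrum (𝓞 K))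
    (hv : (ℓ : 𝓞 K) ∈ v.asIdeal) :
    (p ^ 1 : ℕ) ^ 2 <
      Nat.card (galoisCohomology (((W.baseChange K).torsionGaloisModule ((p ^ 1 : ℕ) : ℤ)).toLocal (Sum.inr v)) 1) := by
  have hp : p.Prime := Fact.out
  rw [natCard_galoisCohomology_one_toLocal_eq_of_kolyvagin_P W K p hK hℓ v hv]
  have h1 : 1 < (p ^ 1) ^ 2 := by
    rw [pow_one]
    exact Nat.one_lt_pow two_ne_zero hp.one_lt
  have h0 : 0 < (p ^ 1) ^ 2 := lt_trans zero_lt_one h1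
  calc (p ^ 1 : ℕ) ^ 2 = (p ^ 1) ^ 2 * 1 := (mul_one _).symm
    _ < (p ^ 1) ^ 2 * (p ^ 1) ^ 2 := Nat.mul_lt_mul_of_pos_left h1 h0
    _ = ((p ^ 1) ^ 2) ^ 2 := (sq _).symm

end Summit.BirchSwinnertonDyer.BirchSwinnertonDyer.Theorems.AdditiveKoly

end
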